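import Summits.BirchSwinnertonDyer.Rank1Residual.Partition.Table
import Summits.BirchSwinnertonDyer.Rank1Residual.Partition.CellOf
import Literature.NumberTheory.EllipticCurves.ComplexMultiplicationNotSemistable
import HarnessLib

/-!
# The PARTITION LEMMA of the rank-`≤ 1` residual cell: every pair `(E, p)` is covered by a class-level published row or lies in a residual class

HONEST FRAMING (cell `b2b-bsdres`, run/shared/lean/b2b/bsd-rank1-residual/, verbatim in every
file): the goal of the cell is to DELETE the COMBINATION-SHAPED residual classes of the
Birch–Swinnerton-Dyer formula for ALL analytic-rank `≤ 1` elliptic curves over `ℚ` — "full BSD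
formula for every rank `≤ 1` curve in class `C`" assembled STRICTLY from published theorems — so
that the rank-`≤ 1` remainder becomes exactly the CONSTRUCTION-SHAPED classes, which are TYPED
(missing-input `Prop`s), NOT attempted. This is not "finishing BSD". This file is NEW WORK of the
cell (a bookkeeping theorem over the cell's own predicates), hence under `Summits/`; it asserts NO
arithmetic fact: it proves that the cell's case split is EXHAUSTIVE.

## What is proved (human GO 2026-08-19T21:53Z: "are we sure the classes fully partition the space?")

Let `W/ℚ` be a globally minimal elliptic curve, `p` a prime, `r = W.analyticRank ≤ 1`. With the
predicates of `Literature/NumberTheory/EllipticCurves/Rank1Residual/Predicates.lean`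
(bsdN/HYPOTHESES.md §Predicates; RESIDUAL-CASES.md §a.0) the main theorem `partition` says

  `Covered W p ∨ Residual W p`,

where
* `Covered W p` (§3) is the disjunction of the CLASS-LEVEL covered rows of RESIDUAL-CASES.md §a.1
  (v27), each the conjunction of the hypotheses of the cited theorem AS THE TREE STATES THEM (the
  per-pair certificate rows C11 Kolyvagin / C12 Kato / C13 2-descent / C14 Wuthrich / C15 Kim are
  NOT class rows and are not used): C1 Skinner 2016 Thm. C (`r = 0`, `p ≥ 3`, ord ∨ mult, irr, ram;
  PUB; tree fact `Skinner2016.thmC_padicValRat_bsd_rank_zero`), C2 Burungale–Castella–Skinner 2025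
  Cor. 1.3.1 (`¬cm`, `p > 3`, ord, irr, (im); PUB\* since v25, flag `BCS25-IMC-equiv@BSTW`; tree
  `BurungaleCastellaSkinner2025.bsdp_of_cor131`), C3 Jetchev–Skinner–Wan 2017 Thm. 1.2.1 (`r = 1`,
  sst, good, irr, `p ≥ 5 ∨ (p = 3 ∧ (ord ∨ a_3 = 0))`; PUB at ordinary `p`, PUB\* flag `JSW-ss` at
  supersingular `p`; tree fact `JetchevSkinnerWan2017.thm121_padicValRat_bsd_rank_one`), C6
  Castella–Grossi–Skinner 2025 Thm. D (`p > 2`, red, good, ¬anom; PUB, informational flag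
  `CGS25-BST-Thm311` pending; tree `Rank1Residual.bsdp_of_good_red_of_not_classX1`), C7 the
  Greenberg–Vatsal chain (`r = 0`, `¬cm`, `p` odd, ord, red, gvpar; PUB literal flag `GV-chain`;
  tree `Rank1Residual.bsdp_of_gvPar_of_analyticRank_eq_zero`), C8 Rubin 1991 / Burungale–Flach
  2024 (cm, `r = 0`; PUB; tree `bsdTriple_of_hasCM_of_L_one_ne_zero`), C10 Kobayashi 2013 Cor. 1.4
  (cm, `r = 1`, `p` odd, good; PUB[sec] flag `KOB13-primary-unread`; tree
  `Kobayashi2013.bsdp_of_cor14`), C16 Yan–Zhu 2026 Thm. 4.15 (`p = 3`, ord, irr, surj(3) ∨ ram(3);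
  PUB\* flag `YZ26@3-BF-ERL-Ohta`; tree `Rank1Residual.bsdp_of_classX10_of_surj` /
  `X10.bsdp_three_of_ram`), C17 Li–Liu–Tian 2024 Thm. 1.1 (cm, `r = 1`, `p` odd, `p` split in `K`;
  PUB; tree `LiLiuTian2024.bsdp_of_thm11`; ⊇ C9 Rubin);
* `Residual W p` (§3) is the disjunction of the cell's residual classes `ClassX1 … ClassX12`
  (tree, RESIDUAL-CASES §a.2 v3 = CLASSES.md) together with THREE predicates transcribed here from
  RESIDUAL-CASES §a.2 v5/v27 because the tree's v3 predicates are narrower (see FINDINGS):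
  `ClassX11a` (`r = 0 ∧ p odd ∧ mult ∧ irr ∧ ¬ram`), `ClassX11b` (`r = 1 ∧ p odd ∧ mult ∧ irr` —
  EVERY rank-one multiplicative irreducible pair, v5 row X11b) and `ClassX9im` (X9 with the printed
  `¬(im)` in place of the census reading `¬surj`).

The proof is by REFLECTION through a finite grid (§1–§2): a `Cell` records the bits of `(E, p)`
that the rows and classes read — `p ∈ {2} / {3} / [5, ∞)`; reduction at `p` (good ordinary / good
supersingular / multiplicative / additive); image (surjective / irreducible non-surjective /
reducible); (im); `r ∈ {0, 1}`; cm; ram; sst; anom; gvpar; `a_3 = 0`; `p` split in `K`; `p`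
ramified in `K` — `3·4·3·2·2·2⁸ = 36 864` cells. `Cell.classify` is the classification TABLE
(each cell ↦ a covered row, a residual class, or `inconsistent`); `Cell.classify_sound` (by
`decide`, kernel evaluation) checks on all 36 864 cells that the named row's / class's hypotheses
(Boolean shadows of the tree predicates) HOLD on the cell and that only cells violating a PROVED
consistency constraint are `inconsistent`; `cellOf W p` computes the cell of a pair (classically),
the atom lemmas `cellOf_*` identify each bit with the tree predicate, `cellOf_consistent` proves the
four constraints for real curves (anom ⇒ red ∧ ord: `goodOrd_of_anom`; red ∧ good ∧ `p > 2` ⇒ ord: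
`goodOrd_of_red_of_good` [Serre 1972 §1.11]; additive ⇒ ¬sst; irr ∧ ¬surj ⇒ ¬(im):
`not_bigIm_of_irr_of_not_surj`), and `partition` / `classify_cellOf_sound` transport the finite
check to every `(E, p)`.

## FINDINGS (said loudly, as asked; details HOME/PARTITION.md)

F1. The tree's `ClassX11` (v3: `mult ∧ irr ∧ (¬ram ∨ (r = 1 ∧ ¬sst) ∨ (r = 1 ∧ p = 3))`) does NOT
  contain the cell `(mult, irr, r = 1, ram, sst, p ≥ 5)` — the domain of the WITHDRAWN row C4
  (Castella 2018 Thm. A, author's erratum); no published class-level row covers it. RESIDUAL-CASES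
  v5 row X11b (`r = 1 ∧ mult ∧ irr`) absorbs it; this file's `ClassX11b` is that predicate. With
  the v3 classes alone the grid partition FAILS exactly on that cell family (`Cell.v3_gap`,
  `Cell.v3_gap_witness`).
F2. The tree's `ClassX9` reads the printed `¬(im)` as `¬surj(p)`. The cell `(¬cm, ord, p ≥ 5, irr,
  surj, ¬(im))` is then in no tree class and in no flag-free row; it is EMPTY for real curves
  (`p ≥ 5`, `ρ̄` onto ⇒ `ρ_{E,p^∞}` onto `GL₂(ℤ_p)`, Serre 1968 IV-23 Lemma 3 — tree theorem
  `serre_hasSurjectiveModNGaloisRep_pow_holds` gives `p`-adic surjectivity; the step to (im) is not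
  in the tree), so this file uses the printed predicate `ClassX9im` and proves `ClassX9 → ClassX9im`.
F3. Cells covered ONLY by a PUB\* row (literal column of the census, NOT an X class): C2-only =
  `¬cm ∧ ord ∧ p ≥ 5 ∧ surj ∧ (im) ∧ ((r = 0 ∧ ¬ram) ∨ (r = 1 ∧ ¬sst))` (flag `BCS25-IMC-equiv@BSTW`,
  referee A R146.2, v25; the BF-free route SU14 + W. Zhang 2014, tree `bsdp_of_S30_of_WZhang2014`,
  reaches only its sub-locus with Zhang's (2)–(3) / two (ram) primes); C16-only = X10a; C3-ss ⊂ X6.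
  If the C2 flag is not lifted this is a CLASS-LEVEL residue without an X label (`Cell.c2Only`,
  characterised in `Cell.c2Only_iff`).
F4. 'U' (no certified Gross–Zagier index; 1 083 classes in `10⁴ ≤ N < 2·10⁴`) is a per-curve
  computation status, not a predicate: every pair of a U curve has a cell, so `partition` places it.

Nothing here is a Literature statement; no named fact is introduced; axioms standard.
References: RESIDUAL-CASES.md §a.0–§a.2 (v27, 2026-08-19T21:15Z); bsdN/HYPOTHESES.md v1/v2;
cell CLASSES.md; the cited rows' tree files named above.
-/

namespace Summit.BirchSwinnertonDyer.Rank1Residual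

open WeierstrassCurve Literature.NumberTheory.EllipticCurves
  Literature.NumberTheory.EllipticCurves.Rank1Residual

section Curve

open scoped Classical

variable {W : WeierstrassCurve ℚ} [W.IsElliptic] [W.IsGloballyMinimal] {p : ℕ} [Fact p.Prime]

/-- A covered row holds at `(E, p)` for some row. [folklore] -/
theorem covered_of_rowHolds (r : Cell.Row) (h : RowHolds W p r) : Covered W p := by
  cases r
  · exact Or.inl h
  · exact Or.inr (Or.inl h)
  · exact Or.inr (Or.inr (Or.inl h))
  · exact Or.inr (Or.inr (Or.inr (Or.inl h)))
  · exact Or.inr (Or.inr (Or.inr (Or.inr (Or.inl h))))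
  · exact Or.inr (Or.inr (Or.inr (Or.inr (Or.inr (Or.inl h)))))
  · exact Or.inr (Or.inr (Or.inr (Or.inr (Or.inr (Or.inr (Or.inl h))))))
  · exact Or.inr (Or.inr (Or.inr (Or.inr (Or.inr (Or.inr (Or.inr (Or.inl h)))))))
  · exact Or.inr (Or.inr (Or.inr (Or.inr (Or.inr (Or.inr (Or.inr (Or.inr h)))))))

/-- A residual class holds at `(E, p)` for some class. [folklore] -/
theorem residual_of_xHolds (x : Cell.XClass) (h : XHolds W p x) : Residual W p := by
  unfold Residual
  cases x
  · exact Or.inl h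
  · exact Or.inr <| Or.inl h
  · exact Or.inr <| Or.inr <| Or.inl h
  · exact Or.inr <| Or.inr <| Or.inr <| Or.inl h
  · exact Or.inr <| Or.inr <| Or.inr <| Or.inr <| Or.inl h
  · exact Or.inr <| Or.inr <| Or.inr <| Or.inr <| Or.inr <| Or.inl h
  · exact Or.inr <| Or.inr <| Or.inr <| Or.inr <| Or.inr <| Or.inr <| Or.inl h
  · exact Or.inr <| Or.inr <| Or.inr <| Or.inr <| Or.inr <| Or.inr <| Or.inr <| Or.inl h
  · exact Or.inr <| Or.inr <| Or.inr <| Or.inr <| Or.inr <| Or.inr <| Or.inr <| Or.inr <| Or.inl h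
  · exact Or.inr <| Or.inr <| Or.inr <| Or.inr <| Or.inr <| Or.inr <| Or.inr <| Or.inr <| Or.inr <|
      Or.inr <| Or.inr <| Or.inr <| Or.inl h
  · exact Or.inr <| Or.inr <| Or.inr <| Or.inr <| Or.inr <| Or.inr <| Or.inr <| Or.inr <| Or.inr <|
      Or.inl h
  · exact Or.inr <| Or.inr <| Or.inr <| Or.inr <| Or.inr <| Or.inr <| Or.inr <| Or.inr <| Or.inr <|
      Or.inr <| Or.inl h
  · exact Or.inr <| Or.inr <| Or.inr <| Or.inr <| Or.inr <| Or.inr <| Or.inr <| Or.inr <| Or.inr <|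
      Or.inr <| Or.inr <| Or.inr <| Or.inr <| Or.inl h
  · exact Or.inr <| Or.inr <| Or.inr <| Or.inr <| Or.inr <| Or.inr <| Or.inr <| Or.inr <| Or.inr <|
      Or.inr <| Or.inr <| Or.inr <| Or.inr <| Or.inr h
  · exact Or.inr <| Or.inr <| Or.inr <| Or.inr <| Or.inr <| Or.inr <| Or.inr <| Or.inr <| Or.inr <|
      Or.inr <| Or.inr <| Or.inl h

/-- Reflection of the covered rows. [folklore] -/
theorem rowHolds_of_cell (hr : W.analyticRank ≤ 1) (r : Cell.Row)
    (h : r.holds (cellOf W p) = true) : RowHolds W p r := by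
  cases r <;>
    simp only [Cell.Row.holds, Cell.rowC1, Cell.rowC2, Cell.rowC3, Cell.rowC6, Cell.rowC7,
      Cell.rowC8, Cell.rowC10, Cell.rowC16, Cell.rowC17, Bool.and_eq_true, Bool.or_eq_true,
      Bool.not_eq_true', and_assoc, cellOf_r0, cellOf_r1 W p hr, cellOf_ge3, cellOf_gt3,
      cellOf_ge5, cellOf_gt2, cellOf_odd, cellOf_isThree, cellOf_goodOrd, cellOf_good, cellOf_mult,
      cellOf_irr, cellOf_isRed, cellOf_surj, cellOf_ram, cellOf_cm, cellOf_cm_false, cellOf_sst,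
      cellOf_anom_false, cellOf_gvpar, cellOf_a3zero, cellOf_bigIm, cellOf_cmSplit] at h <;>
    exact h

/-- Reflection of the residual classes. [folklore] -/
theorem xHolds_of_cell (hr : W.analyticRank ≤ 1) (x : Cell.XClass)
    (h : x.holds (cellOf W p) = true) : XHolds W p x := by
  cases x <;>
    simp only [Cell.XClass.holds, Cell.x1, Cell.x2, Cell.x3, Cell.x4, Cell.x5, Cell.x6, Cell.x7,
      Cell.x8, Cell.x9, Cell.x9im, Cell.x10, Cell.x11, Cell.x11a, Cell.x11b, Cell.x12,
      Bool.and_eq_true, Bool.or_eq_true, Bool.not_eq_true', Bool.and_eq_false_imp, and_assoc,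
      or_assoc, cellOf_r0, cellOf_r1 W p hr, cellOf_ge5, cellOf_gt2,
      cellOf_odd, cellOf_isTwo, cellOf_isThree, cellOf_goodOrd, cellOf_goodSS, cellOf_good,
      cellOf_good_false, cellOf_mult, cellOf_addv, cellOf_irr, cellOf_isRed, cellOf_surj_false,
      cellOf_ram_false, cellOf_cm, cellOf_cm_false, cellOf_sst, cellOf_sst_false, cellOf_anom,
      cellOf_gvpar_false, cellOf_a3zero, cellOf_a3zero_false, cellOf_bigIm_false,
      cellOf_cmSplit_false, cellOf_cmRam] at h
  · -- X1
    exact ⟨h.1, h.2.1, h.2.2.1, h.2.2.2.1, fun ⟨h0, hg⟩ => h.2.2.2.2 h0 hg⟩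
  · exact h
  · exact h
  · exact h
  · exact h
  · exact h
  · exact h
  · -- X8
    obtain ⟨h3, hss, ha⟩ := h
    subst h3
    exact ⟨rfl, hss, ha⟩
  · exact h
  · exact h
  · -- X10
    obtain ⟨h3, ho, hi, hor⟩ := h
    subst h3
    exact ⟨rfl, ho, hi, hor⟩
  · exact h
  · exact h
  · exact h
  · -- X12
    obtain ⟨hcm, h1, hor⟩ := h
    refine ⟨hcm, h1, ?_⟩
    rcases hor with h2 | ⟨h3, hns⟩ | hram | hng
    · exact Or.inl h2
    · subst h3; exact Or.inr (Or.inl ⟨rfl, hns⟩)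
    · exact Or.inr (Or.inr (Or.inl hram))
    · exact Or.inr (Or.inr (Or.inr hng))

/-- `Covered` from the cell. [folklore] -/
theorem covered_of_cell (hr : W.analyticRank ≤ 1) (h : (cellOf W p).covered = true) : Covered W p := by
  simp only [Cell.covered, Bool.or_eq_true] at h
  rcases h with (((((((h | h) | h) | h) | h) | h) | h) | h) | h
  · exact covered_of_rowHolds .C1 (rowHolds_of_cell hr .C1 h)
  · exact covered_of_rowHolds .C2 (rowHolds_of_cell hr .C2 h)
  · exact covered_of_rowHolds .C3 (rowHolds_of_cell hr .C3 h)
  · exact covered_of_rowHolds .C6 (rowHolds_of_cell hr .C6 h)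
  · exact covered_of_rowHolds .C7 (rowHolds_of_cell hr .C7 h)
  · exact covered_of_rowHolds .C8 (rowHolds_of_cell hr .C8 h)
  · exact covered_of_rowHolds .C10 (rowHolds_of_cell hr .C10 h)
  · exact covered_of_rowHolds .C16 (rowHolds_of_cell hr .C16 h)
  · exact covered_of_rowHolds .C17 (rowHolds_of_cell hr .C17 h)

/-- `Residual` from the cell. [folklore] -/
theorem residual_of_cell (hr : W.analyticRank ≤ 1) (h : (cellOf W p).residual = true) :
    Residual W p := by
  simp only [Cell.residual, Bool.or_eq_true] at h
  rcases h with (((((((((((((h | h) | h) | h) | h) | h) | h) | h) | h) | h) | h) | h) | h) | h) | h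
  · exact residual_of_xHolds .X1 (xHolds_of_cell hr .X1 h)
  · exact residual_of_xHolds .X2 (xHolds_of_cell hr .X2 h)
  · exact residual_of_xHolds .X3 (xHolds_of_cell hr .X3 h)
  · exact residual_of_xHolds .X4 (xHolds_of_cell hr .X4 h)
  · exact residual_of_xHolds .X5 (xHolds_of_cell hr .X5 h)
  · exact residual_of_xHolds .X6 (xHolds_of_cell hr .X6 h)
  · exact residual_of_xHolds .X7 (xHolds_of_cell hr .X7 h)
  · exact residual_of_xHolds .X8 (xHolds_of_cell hr .X8 h)
  · exact residual_of_xHolds .X9 (xHolds_of_cell hr .X9 h)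
  · exact residual_of_xHolds .X10 (xHolds_of_cell hr .X10 h)
  · exact residual_of_xHolds .X11 (xHolds_of_cell hr .X11 h)
  · exact residual_of_xHolds .X12 (xHolds_of_cell hr .X12 h)
  · exact residual_of_xHolds .X9im (xHolds_of_cell hr .X9im h)
  · exact residual_of_xHolds .X11a (xHolds_of_cell hr .X11a h)
  · exact residual_of_xHolds .X11b (xHolds_of_cell hr .X11b h)

/-- The tree's v3 classes from the cell. [folklore] -/
theorem residualV3_of_cell (hr : W.analyticRank ≤ 1) (h : (cellOf W p).residualV3 = true) :
    ClassX1 W p ∨ ClassX2 W p ∨ ClassX3 W p ∨ ClassX4 W p ∨ ClassX5 W p ∨ ClassX6 W p ∨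
      ClassX7 W p ∨ ClassX8 W p ∨ ClassX9 W p ∨ ClassX10 W p ∨ ClassX11 W p ∨ ClassX12 W p := by
  simp only [Cell.residualV3, Bool.or_eq_true] at h
  rcases h with ((((((((((h | h) | h) | h) | h) | h) | h) | h) | h) | h) | h) | h
  · exact Or.inl (xHolds_of_cell hr .X1 h)
  · exact Or.inr <| Or.inl (xHolds_of_cell hr .X2 h)
  · exact Or.inr <| Or.inr <| Or.inl (xHolds_of_cell hr .X3 h)
  · exact Or.inr <| Or.inr <| Or.inr <| Or.inl (xHolds_of_cell hr .X4 h)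
  · exact Or.inr <| Or.inr <| Or.inr <| Or.inr <| Or.inl (xHolds_of_cell hr .X5 h)
  · exact Or.inr <| Or.inr <| Or.inr <| Or.inr <| Or.inr <| Or.inl (xHolds_of_cell hr .X6 h)
  · exact Or.inr <| Or.inr <| Or.inr <| Or.inr <| Or.inr <| Or.inr <| Or.inl (xHolds_of_cell hr .X7 h)
  · exact Or.inr <| Or.inr <| Or.inr <| Or.inr <| Or.inr <| Or.inr <| Or.inr <| Or.inl
      (xHolds_of_cell hr .X8 h)
  · exact Or.inr <| Or.inr <| Or.inr <| Or.inr <| Or.inr <| Or.inr <| Or.inr <| Or.inr <| Or.inl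
      (xHolds_of_cell hr .X9 h)
  · exact Or.inr <| Or.inr <| Or.inr <| Or.inr <| Or.inr <| Or.inr <| Or.inr <| Or.inr <| Or.inr <|
      Or.inl (xHolds_of_cell hr .X10 h)
  · exact Or.inr <| Or.inr <| Or.inr <| Or.inr <| Or.inr <| Or.inr <| Or.inr <| Or.inr <| Or.inr <|
      Or.inr <| Or.inl (xHolds_of_cell hr .X11 h)
  · exact Or.inr <| Or.inr <| Or.inr <| Or.inr <| Or.inr <| Or.inr <| Or.inr <| Or.inr <| Or.inr <|
      Or.inr <| Or.inr (xHolds_of_cell hr .X12 h)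

/-! ## §4 The partition theorems -/

/-- **PARTITION LEMMA** (human GO 2026-08-19T21:53Z). For every globally minimal elliptic curve
`E/ℚ` of analytic rank `≤ 1` and every prime `p`: EITHER the hypotheses of a class-level covered row
of RESIDUAL-CASES §a.1 hold at `(E, p)` (`Covered`: C1, C2 [PUB\*], C3, C6, C7, C8, C10, C16 [PUB\*],
C17 as the tree states them) OR `(E, p)` lies in a residual class (`Residual`: the tree's X1–X12, or
X9 as printed / X11a / X11b of v5). Proof: the cell of `(E, p)` is consistent (`cellOf_consistent`),
the table covers every consistent cell (`Cell.grid_partition`, kernel `decide` over 36 864 cells),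
and each cell-level target reflects to the tree predicate (`covered_of_cell`, `residual_of_cell`).
Nothing arithmetic is asserted. [folklore] -/
theorem partition (hr : W.analyticRank ≤ 1) : Covered W p ∨ Residual W p := by
  rcases Cell.grid_partition (cellOf W p) (cellOf_consistent W p) with h | h
  · exact Or.inl (covered_of_cell hr h)
  · exact Or.inr (residual_of_cell hr h)

/-- **The table applied to a real pair is sound**: whatever `Cell.classify (cellOf W p)` names —
a covered row or a residual class — holds at `(E, p)`; and it never answers `inconsistent`.
[folklore] -/
theorem classify_cellOf_sound (hr : W.analyticRank ≤ 1) :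
    match Cell.classify (cellOf W p) with
    | .covered r => RowHolds W p r
    | .residual x => XHolds W p x
    | .inconsistent => False := by
  have hs := Cell.classify_sound (cellOf W p)
  unfold Cell.classifySound at hs
  split
  · next r hr' => simp only [hr'] at hs; exact rowHolds_of_cell hr r hs
  · next x hx => simp only [hx] at hs; exact xHolds_of_cell hr x hs
  · next hi => exact Cell.classify_ne_inconsistent _ (cellOf_consistent W p) hi

/-- **Where the tree's v3 classes alone leave holes** (findings F1/F2, on curves): a pair of
analytic rank `≤ 1` in no covered row and in none of the tree's classes X1–X12 is EITHER a rank-one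
pair at a multiplicative `p ≥ 5` with `E[p]` irreducible, a (ram) witness, `E` semistable and
non-CM — the withdrawn C4's domain — lying in X11b, OR a non-CM good ordinary irreducible pair at
`p ≥ 5` with SURJECTIVE `ρ̄_{E,p}` but without (im) — empty by Serre 1968 IV-23 Lemma 3 (not a tree
theorem) — lying in X9im. [folklore] -/
theorem gap_of_not_covered_of_not_residualV3 (hr : W.analyticRank ≤ 1) (hc : ¬ Covered W p)
    (hx : ¬ (ClassX1 W p ∨ ClassX2 W p ∨ ClassX3 W p ∨ ClassX4 W p ∨ ClassX5 W p ∨ ClassX6 W p ∨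
      ClassX7 W p ∨ ClassX8 W p ∨ ClassX9 W p ∨ ClassX10 W p ∨ ClassX11 W p ∨ ClassX12 W p)) :
    (Mult W p ∧ Irr W p ∧ W.analyticRank = 1 ∧ Ram W p ∧ Semistable W ∧ 5 ≤ p ∧ ¬ W.HasCM ∧
        ClassX11b W p) ∨
      (¬ W.HasCM ∧ GoodOrd W p ∧ 5 ≤ p ∧ Surj W p ∧ ¬ BigIm W p ∧ ClassX9im W p) := by
  have hcell : ¬ ((cellOf W p).covered = true ∨ (cellOf W p).residualV3 = true) := by
    rintro (h | h)
    · exact hc (covered_of_cell hr h)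
    · exact hx (residualV3_of_cell hr h)
  rcases Cell.v3_gap (cellOf W p) (cellOf_consistent W p) hcell with ⟨hf, hx11b⟩ | ⟨hf, hx9⟩
  · left
    simp only [Cell.f1Shape, Bool.and_eq_true, Bool.not_eq_true', and_assoc, cellOf_mult, cellOf_irr,
      cellOf_r1 W p hr, cellOf_ram, cellOf_sst, cellOf_ge5, cellOf_cm_false] at hf
    exact ⟨hf.1, hf.2.1, hf.2.2.1, hf.2.2.2.1, hf.2.2.2.2.1, hf.2.2.2.2.2.1, hf.2.2.2.2.2.2,
      xHolds_of_cell hr .X11b hx11b⟩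
  · right
    simp only [Cell.f2Shape, Bool.and_eq_true, Bool.or_eq_true, Bool.not_eq_true', and_assoc,
      cellOf_cm_false, cellOf_goodOrd, cellOf_ge5, cellOf_surj, cellOf_bigIm_false, cellOf_r0,
      cellOf_r1 W p hr, cellOf_ram_false, cellOf_sst_false] at hf
    exact ⟨hf.1, hf.2.1, hf.2.2.1, hf.2.2.2.1, hf.2.2.2.2.1, xHolds_of_cell hr .X9im hx9⟩

/-! ### CM is decided before the supersingular classes (referee acceptance test, point 7)

The table `Cell.classify` tests `cm` BEFORE the reduction type, so a CM pair at an odd prime is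
sent to C8 (`r = 0`, Rubin / Burungale–Flach), C17 (`p` split, Li–Liu–Tian), C10 (good `p`,
Kobayashi) or X12 — never to X6 / X7.  For real curves this is forced, not a convention: a CM curve
over `ℚ` is never semistable (harvest-1's tree theorem `not_semistable_of_hasCM`, p198455), so the
cell of a CM pair has `sst = false` and `ClassX6` (which requires `sst`) never meets CM
(`ClassX6.not_hasCM`); the tree predicate `ClassX7 = ss ∧ ¬sst` DOES meet CM
(`classX7_of_hasCM_of_goodSS`), which is exactly why the table must test `cm` first. -/

/-- The classification of a consistent CM cell at an odd prime: C8 if `r = 0`, else C17 if `p` is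
split in `K`, else C10 if `p` is good, else X12 — never X6 / X7 (the table tests `cm` before the
reduction type). [folklore] -/
theorem Cell.classify_of_cm (c : Cell) (hc : c.consistent = true) (h2 : c.isTwo = false)
    (hcm : c.cm = true) :
    c.classify = (if c.r0 then .covered .C8 else if c.cmSplit then .covered .C17
      else if c.good then .covered .C10 else .residual .X12) := by
  simp [Cell.classify, hc, h2, hcm]

/-- Hence a consistent CM cell is never classified X6 or X7 (at `p = 2` every cell is X5).
[folklore] -/
theorem Cell.classify_ne_X6_X7_of_cm (c : Cell) (hc : c.consistent = true) (hcm : c.cm = true) :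
    c.classify ≠ .residual .X6 ∧ c.classify ≠ .residual .X7 := by
  by_cases h2 : c.isTwo = true
  · have : c.classify = .residual .X5 := by simp [Cell.classify, hc, h2]
    rw [this]; exact ⟨by decide, by decide⟩
  · rw [Cell.classify_of_cm c hc (by simpa using h2) hcm]
    split_ifs <;> exact ⟨by decide, by decide⟩

/-- **cm ⇒ the cell has `sst = false`** (a CM curve over `ℚ` is never semistable: harvest-1's
`not_semistable_of_hasCM`, Silverman ATAEC II.6.4 / Ogg 1966).
[cite: SilvermanATAEC1994, Thm. II.6.4 (PDF p. 148)] -/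
theorem cellOf_sst_false_of_hasCM (h : W.HasCM) : (cellOf W p).sst = false :=
  (cellOf_sst_false W p).2 (not_semistable_of_hasCM W h)

/-- **A CM pair is never classified X6 / X7 by the table** (CM decided first; consistent by
`cellOf_consistent`). [folklore] -/
theorem classify_cellOf_ne_X6_X7_of_hasCM (h : W.HasCM) :
    Cell.classify (cellOf W p) ≠ .residual .X6 ∧ Cell.classify (cellOf W p) ≠ .residual .X7 :=
  Cell.classify_ne_X6_X7_of_cm _ (cellOf_consistent W p) ((cellOf_cm W p).2 h)

/-- And a CM pair is never in the tree class X6 at all (`ClassX6` requires `sst`; harvest-1's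
`ClassX6.not_hasCM`). [cite: SilvermanATAEC1994, Thm. II.6.4 (PDF p. 148)] -/
theorem not_classX6_of_hasCM (h : W.HasCM) : ¬ ClassX6 W p :=
  fun hX => ClassX6.not_hasCM W hX h

end Curve

end Summit.BirchSwinnertonDyer.Rank1Residual
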